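import Literature.NumberTheory.EllipticCurves.WeilPairingProofs
import Literature.NumberTheory.GaloisRepresentations.GaloisRep
import Summits.BirchSwinnertonDyer.BirchSwinnertonDyer.Theorems.PrintCf2SplitBadTwoCMPrimaryStructure
import HarnessLib

/-!
# Crux `PrintCf2.SplitBadTwoRankOneOfFacts` (item stmt-BirchSwinnertonDyer-20368), road α over the CM field:
# the PRODUCT of the two CM characters is the CYCLOTOMIC character — `ψ_𝔭 · ψ_𝔭̄ = ε` on `E[𝔭^k] ⊕ E[𝔭̄^k]`

Cell `bsd-print-cf2`, width seat `bsd-line-cf2-p1-w2` g7; `--supports stmt-BirchSwinnertonDyer-20368` (helper); sequel of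
`…CMPrimaryStructure` (`cmPrimary_structure_two`: `Γ_L` acts on each CM summand `C[2^k]` by an integer scalar). HONEST FRAMING: nothing
here closes a crux or a stub; BSD is not proved by any of this; no summit statement is proved by this seat. No definition is introduced.

THE STATEMENT. `W/ℚ` elliptic with `j = −3375`, `L` a number field with `θ² = −7`, `π² = π − 2`, `r` a root of `X² − X + 2` in `ℤ₂`,
`C₁ = E[𝔭^∞]` (`π` acts as `r`), `C₂ = E[𝔭̄^∞]` (`π` acts as `1 − r`). If `σ ∈ Γ_L` acts on `C₁[2^k]` as the integer `N₁` and on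
`C₂[2^k]` as `N₂`, then `N₁ N₂ ≡ ε(σ) (mod 2^k)`, `ε = GaloisRep.cyclotomicCharacter L 2` (**`cmPrimary_characters_mul_two`**). Proof:
the Weil pairing `e_{2^k}` (tree: `exists_weilPairing_holds` — bilinear, alternating, non-degenerate, `Γ_L`-equivariant, values in
`μ_{2^k}`) on generators `S`, `T` of the cyclic groups `C₁[2^k]`, `C₂[2^k]`: `ζ = e(S, T)` is a PRIMITIVE `2^k`-th root of unity (a
smaller order would make `2^{k−1}T` pair trivially with `E[2^k] = ℤS ⊕ ℤT`), and `σζ = e(σS, σT) = ζ^{N₁N₂}` while `σζ = ζ^{ε(σ)}`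
(`GaloisRep.cyclotomicCharacter_spec`). This is `det ρ_{E,2} = ε` read on the CM splitting: at a place `v ∣ 2` the two characters
have COMPLEMENTARY ramification (one finitely ramified iff the other is `ε` up to a finitely ramified twist).

References: [SilvermanAEC2009] III.§8 Prop. 8.1, and Cornell–Silverman–Stevens Ch. II §7–8 (`det ρ̄_m = χ_m`); K. Rubin, LNM 1716 §2;
J.-P. Serre, *Abelian ℓ-adic representations* (1968) I §1.2.
-/

noncomputable section

open scoped Classical

set_option linter.dupNamespace false
set_option autoImplicit false

namespace Summit.BirchSwinnertonDyer.BirchSwinnertonDyer.Theorems.PrintCf2.CMPrimes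

section Weil

open WeierstrassCurve Literature.NumberTheory.EllipticCurves Literature.NumberTheory.GaloisRepresentations Field

variable {F : Type} [Field F] {V : WeierstrassCurve F} {m : ℕ}

/-- Powers in the first variable of a pairing additive in the first variable with values of `m`-th roots of unity:
`e (n • S) T = (e S T)^n`. [folklore] -/
theorem pairing_nsmul_left (e : V.geomTorsion m → V.geomTorsion m → AlgebraicClosure F)
    (hpow : ∀ S T, e S T ^ m = 1) (hm : 1 ≤ m) (hadd : ∀ S₁ S₂ T, e (S₁ + S₂) T = e S₁ T * e S₂ T)
    (S T : V.geomTorsion m) (n : ℕ) : e (n • S) T = e S T ^ n := by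
  have h0 : e 0 T = 1 := by
    have h := hadd 0 0 T
    rw [add_zero] at h
    have hne : e 0 T ≠ 0 := fun h0 ↦ by
      have := hpow 0 T; rw [h0, zero_pow (by omega)] at this; exact zero_ne_one this
    -- `x = x * x`, `x ≠ 0` ⇒ `x = 1`
    have := mul_left_cancel₀ hne (h.symm.trans (mul_one _).symm)
    exact this
  induction n with
  | zero => rw [zero_smul, pow_zero, h0]
  | succ n ih => rw [add_smul, one_smul, hadd, ih, pow_succ]

/-- Powers in the second variable: `e S (n • T) = (e S T)^n`. [folklore] -/
theorem pairing_nsmul_right (e : V.geomTorsion m → V.geomTorsion m → AlgebraicClosure F)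
    (hpow : ∀ S T, e S T ^ m = 1) (hm : 1 ≤ m) (hadd : ∀ S T₁ T₂, e S (T₁ + T₂) = e S T₁ * e S T₂)
    (S T : V.geomTorsion m) (n : ℕ) : e S (n • T) = e S T ^ n := by
  have h0 : e S 0 = 1 := by
    have h := hadd S 0 0
    rw [add_zero] at h
    have hne : e S 0 ≠ 0 := fun h0 ↦ by
      have := hpow S 0; rw [h0, zero_pow (by omega)] at this; exact zero_ne_one this
    exact mul_left_cancel₀ hne (h.symm.trans (mul_one _).symm)
  induction n with
  | zero => rw [zero_smul, pow_zero, h0]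
  | succ n ih => rw [add_smul, one_smul, hadd, ih, pow_succ]

/-- **`ψ_𝔭 · ψ_𝔭̄ = ε` on the CM summands.** `W/ℚ` elliptic, `j = −3375`, `L` a number field with `θ² = −7`, `π ∈ End_{L̄}(E_L)` with
`π² = π − 2`, `r` a `2`-adic root of `X² − X + 2`, `C₁`, `C₂ ≤ E_L[2^∞]` the subgroups where `π` acts as `r`, resp. `1 − r`. If `σ ∈ Γ_L`
acts on `C₁[2^k]` as `N₁ ∈ ℤ` and on `C₂[2^k]` as `N₂ ∈ ℤ` (such integers exist: `cmPrimary_structure_two`), then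
`N₁ · N₂ ≡ ε(σ) (mod 2^k)`: `((N₁N₂ : ℤ) : ℤ₂) − ε(σ) ∈ 2^k ℤ₂`. Via the Weil pairing `e_{2^k}` on generators of the two cyclic groups.
[cite: SilvermanAEC2009, Prop. III.8.1 (a)–(d)] -/
theorem cmPrimary_characters_mul_two (W : WeierstrassCurve ℚ) [W.IsElliptic] (hj : W.j = -3375)
    (L : Type) [Field L] [NumberField L] {θ : L} (hθ : θ ^ 2 = -7)
    {π : AddMonoid.End (W.baseChange L).geomPoints} (hπ : π ∈ (W.baseChange L).geomEndRing) (hrel : π * π = π - 2)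
    {r : ℤ_[2]} (hr : r * r = r - 2) {C₁ C₂ : AddSubgroup ((W.baseChange L).geomPrimaryTorsion 2)}
    (hC₁ : ∀ x, x ∈ C₁ ↔ ∀ (k : ℕ) (N : ℤ), 2 ^ k • x = 0 →
        ((N : ℤ_[2]) - r) ∈ (Ideal.span {(2 : ℤ_[2]) ^ k} : Ideal ℤ_[2]) →
          π (x : (W.baseChange L).geomPoints) = N • (x : (W.baseChange L).geomPoints))
    (hC₂ : ∀ x, x ∈ C₂ ↔ ∀ (k : ℕ) (N : ℤ), 2 ^ k • x = 0 →
        ((N : ℤ_[2]) - (1 - r)) ∈ (Ideal.span {(2 : ℤ_[2]) ^ k} : Ideal ℤ_[2]) →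
          π (x : (W.baseChange L).geomPoints) = N • (x : (W.baseChange L).geomPoints))
    (σ : absoluteGaloisGroup L) (k : ℕ) {N₁ N₂ : ℤ}
    (hN₁ : ∀ x ∈ C₁, 2 ^ k • x = 0 → σ • x = N₁ • x) (hN₂ : ∀ x ∈ C₂, 2 ^ k • x = 0 → σ • x = N₂ • x) :
    (((N₁ * N₂ : ℤ) : ℤ_[2]) - ((GaloisRep.cyclotomicCharacter L 2 σ : ℤ_[2]ˣ) : ℤ_[2])) ∈
      (Ideal.span {(2 : ℤ_[2]) ^ k} : Ideal ℤ_[2]) := by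
  haveI : Fact (Nat.Prime 2) := ⟨Nat.prime_two⟩
  -- `k = 0`: nothing to prove
  rcases Nat.eq_zero_or_pos k with rfl | hk
  · rw [pow_zero, Ideal.span_singleton_one]; exact Submodule.mem_top
  set M := ↥((W.baseChange L).geomPrimaryTorsion 2) with hM_def
  -- the complementary eigen-pair and generators of the two cyclic groups `Cᵢ[2^k]`
  have hr' : (1 - r) * (1 - r) = (1 - r) - 2 := by linear_combination hr
  obtain ⟨hinf, hsup, -, -⟩ := cmPrimary_compl_two W hj L hθ hπ hrel hr hC₁ hC₂
  obtain ⟨-, -, -, -, hgen₁, -⟩ := cmPrimary_structure_two W hj L hθ hπ hrel hr hC₁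
  have hC₂' : ∀ x, x ∈ C₂ ↔ ∀ (k : ℕ) (N : ℤ), 2 ^ k • x = 0 →
      ((N : ℤ_[2]) - (1 - r)) ∈ (Ideal.span {(2 : ℤ_[2]) ^ k} : Ideal ℤ_[2]) →
        π (x : (W.baseChange L).geomPoints) = N • (x : (W.baseChange L).geomPoints) := hC₂
  obtain ⟨-, -, -, -, hgen₂, -⟩ := cmPrimary_structure_two W hj L hθ hπ hrel hr' hC₂'
  obtain ⟨g₁, hg₁C, hg₁ord, hg₁gen⟩ := hgen₁ k
  obtain ⟨g₂, hg₂C, hg₂ord, hg₂gen⟩ := hgen₂ k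
  have hmemT : ∀ {n : ℕ} {x : M}, x ∈ AddSubgroup.torsionBy M (n : ℕ) ↔ n • x = 0 :=
    fun {n} {x} ↦ AddSubgroup.torsionBy.nsmul_iff
  have hmemT' : ∀ {n : ℕ} {P : (W.baseChange L).geomPoints}, P ∈ (W.baseChange L).geomTorsion (n : ℕ) ↔ n • P = 0 :=
    fun {n} {P} ↦ AddSubgroup.torsionBy.nsmul_iff
  have hg₁k : 2 ^ k • g₁ = 0 := by rw [← hg₁ord]; exact addOrderOf_nsmul_eq_zero g₁
  have hg₂k : 2 ^ k • g₂ = 0 := by rw [← hg₂ord]; exact addOrderOf_nsmul_eq_zero g₂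
  have hval : ∀ {x : M} {n : ℕ}, n • x = 0 → n • (x : (W.baseChange L).geomPoints) = 0 := fun {x} {n} h ↦ by
    have := congrArg Subtype.val h
    rwa [AddSubmonoidClass.coe_nsmul, ZeroMemClass.coe_zero] at this
  -- the `2^k`-torsion points `S = g₁`, `T = g₂` of `E_L`
  set S : (W.baseChange L).geomTorsion (2 ^ k : ℕ) := ⟨(g₁ : (W.baseChange L).geomPoints), hmemT'.mpr (hval hg₁k)⟩ with hS
  set T : (W.baseChange L).geomTorsion (2 ^ k : ℕ) := ⟨(g₂ : (W.baseChange L).geomPoints), hmemT'.mpr (hval hg₂k)⟩ with hT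
  -- the Weil pairing at level `2^k`
  have hm2 : 2 ≤ 2 ^ k := by
    calc 2 = 2 ^ 1 := (pow_one 2).symm
      _ ≤ 2 ^ k := Nat.pow_le_pow_right (by norm_num) hk
  have hm1 : 1 ≤ 2 ^ k := le_trans (by norm_num) hm2
  have hmL : ((2 ^ k : ℕ) : L) ≠ 0 := by exact_mod_cast pow_ne_zero k (two_ne_zero (α := L))
  obtain ⟨e, hpow, haddl, haddr, hself, hnondeg, hgal⟩ := exists_weilPairing_holds (W.baseChange L) (2 ^ k) hm2 hmL
  set ζ := e S T with hζ
  -- (1) `σ S = N₁ S = n₁ S`, `σ T = n₂ T` with natural representatives `nᵢ ≡ Nᵢ (mod 2^k)`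
  have hrep : ∀ (N : ℤ), ∃ n : ℕ, ((2 ^ k : ℕ) : ℤ) ∣ N - n := fun N ↦ by
    refine ⟨(N % (2 ^ k : ℕ)).toNat, ?_⟩
    rw [Int.toNat_of_nonneg (Int.emod_nonneg _ (by exact_mod_cast pow_ne_zero k two_ne_zero))]
    exact (Int.mod_modEq N _).dvd
  obtain ⟨n₁, hn₁⟩ := hrep N₁
  obtain ⟨n₂, hn₂⟩ := hrep N₂
  have hσS : σ • S = n₁ • S := by
    apply Subtype.ext
    rw [AddSubgroup.torsionBy.coe_smul, AddSubmonoidClass.coe_nsmul]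
    change σ • (g₁ : (W.baseChange L).geomPoints) = n₁ • (g₁ : (W.baseChange L).geomPoints)
    have h := congrArg Subtype.val (hN₁ g₁ hg₁C hg₁k)
    rw [primaryComponent.coe_smul, AddSubgroupClass.coe_zsmul] at h
    rw [h, ← natCast_zsmul]
    exact zsmul_eq_zsmul_of_pow_dvd_sub (p := 2) (hval hg₁k) (by exact_mod_cast hn₁)
  have hσT : σ • T = n₂ • T := by
    apply Subtype.ext
    rw [AddSubgroup.torsionBy.coe_smul, AddSubmonoidClass.coe_nsmul]
    change σ • (g₂ : (W.baseChange L).geomPoints) = n₂ • (g₂ : (W.baseChange L).geomPoints)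
    have h := congrArg Subtype.val (hN₂ g₂ hg₂C hg₂k)
    rw [primaryComponent.coe_smul, AddSubgroupClass.coe_zsmul] at h
    rw [h, ← natCast_zsmul]
    exact zsmul_eq_zsmul_of_pow_dvd_sub (p := 2) (hval hg₂k) (by exact_mod_cast hn₂)
  have hσζ : σ • ζ = ζ ^ (n₁ * n₂) := by
    rw [hζ, hgal, hσS, hσT, pairing_nsmul_left e hpow hm1 haddl, pairing_nsmul_right e hpow hm1 haddr, ← pow_mul,
      mul_comm]
  -- (2) `σ ζ = ζ^{ε(σ)}`
  have hζpow : ζ ^ 2 ^ k = 1 := hpow S T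
  have hεζ := GaloisRep.cyclotomicCharacter_spec (K := L) (ℓ := 2) (k := k) σ ζ hζpow
  set c : ℕ := ((GaloisRep.cyclotomicCharacter L 2 σ).val.toZModPow k).val with hc
  -- (3) `ζ` has order exactly `2^k`
  have hord : orderOf ζ = 2 ^ k := by
    obtain ⟨j, hjk, hj'⟩ := (Nat.dvd_prime_pow Nat.prime_two).mp (orderOf_dvd_of_pow_eq_one hζpow)
    rw [hj']
    by_contra hne
    have hjlt : j < k := lt_of_le_of_ne hjk (fun h ↦ hne (by rw [h]))
    -- then `ζ^{2^{k-1}} = 1`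
    obtain ⟨i, rfl⟩ := Nat.exists_eq_add_of_lt hjlt
    have hζ1 : ζ ^ 2 ^ (j + i) = 1 := by
      rw [pow_add, pow_mul, ← hj', pow_orderOf_eq_one, one_pow]
    -- `T' = 2^{j+i} T` pairs trivially with `S` and with `T`, hence with everything: contradiction with `ord g₂ = 2^{j+i+1}`
    set T' : (W.baseChange L).geomTorsion (2 ^ (j + i + 1) : ℕ) := (2 ^ (j + i)) • T with hT'
    have hST' : e S T' = 1 := by rw [hT', pairing_nsmul_right e hpow hm1 haddr, ← hζ, hζ1]
    have hTT' : e T T' = 1 := by rw [hT', pairing_nsmul_right e hpow hm1 haddr, hself, one_pow]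
    have hall : ∀ R, e R T' = 1 := by
      intro R
      -- `R = a S + b T`
      have hRM : (R : (W.baseChange L).geomPoints) ∈ (W.baseChange L).geomPrimaryTorsion 2 :=
        (AddCommGroup.mem_primaryComponent).mpr ⟨j + i + 1, hmemT'.mp R.2⟩
      have hx : (⟨R, hRM⟩ : M) ∈ C₁ ⊔ C₂ := hsup ▸ AddSubgroup.mem_top _
      obtain ⟨x₁, hx₁, x₂, hx₂, hx12⟩ := AddSubgroup.mem_sup.mp hx
      have hk12 : 2 ^ (j + i + 1) • (x₁ + x₂) = 0 := by
        rw [hx12]; exact Subtype.ext (by rw [AddSubmonoidClass.coe_nsmul, ZeroMemClass.coe_zero]; exact hmemT'.mp R.2)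
      obtain ⟨hx₁k, hx₂k⟩ := nsmul_eq_zero_of_add hinf hx₁ hx₂ hk12
      have hx₁g : x₁ ∈ AddSubgroup.zmultiples g₁ := by
        rw [← hg₁gen]; exact AddSubgroup.mem_inf.mpr ⟨hx₁, hmemT.mpr hx₁k⟩
      have hx₂g : x₂ ∈ AddSubgroup.zmultiples g₂ := by
        rw [← hg₂gen]; exact AddSubgroup.mem_inf.mpr ⟨hx₂, hmemT.mpr hx₂k⟩
      obtain ⟨a, ha⟩ := AddSubgroup.mem_zmultiples_iff.mp hx₁g
      obtain ⟨b, hb⟩ := AddSubgroup.mem_zmultiples_iff.mp hx₂g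
      obtain ⟨a', ha'⟩ := hrep a
      obtain ⟨b', hb'⟩ := hrep b
      have hRab : R = a' • S + b' • T := by
        apply Subtype.ext
        rw [AddSubgroup.coe_add, AddSubmonoidClass.coe_nsmul, AddSubmonoidClass.coe_nsmul]
        change _ = a' • (g₁ : (W.baseChange L).geomPoints) + b' • (g₂ : (W.baseChange L).geomPoints)
        have e12 := congrArg Subtype.val hx12
        rw [AddSubgroup.coe_add] at e12
        change (x₁ : (W.baseChange L).geomPoints) + (x₂ : (W.baseChange L).geomPoints) = R at e12
        rw [← e12, ← ha, ← hb, AddSubgroupClass.coe_zsmul, AddSubgroupClass.coe_zsmul, ← natCast_zsmul, ← natCast_zsmul]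
        rw [zsmul_eq_zsmul_of_pow_dvd_sub (p := 2) (hval hg₁k) (by exact_mod_cast ha'),
          zsmul_eq_zsmul_of_pow_dvd_sub (p := 2) (hval hg₂k) (by exact_mod_cast hb')]
      rw [hRab, haddl, pairing_nsmul_left e hpow hm1 haddl, pairing_nsmul_left e hpow hm1 haddl, hST', hTT', one_pow,
        one_pow, one_mul]
    have hT'0 : T' = 0 := hnondeg T' hall
    have h2 : 2 ^ (j + i) • g₂ = 0 := by
      apply Subtype.ext
      have := congrArg Subtype.val hT'0
      rw [hT', AddSubmonoidClass.coe_nsmul] at this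
      rw [AddSubmonoidClass.coe_nsmul, ZeroMemClass.coe_zero]
      exact this
    refine nsmul_ne_zero_of_lt_addOrderOf (pow_ne_zero _ two_ne_zero) ?_ h2
    rw [hg₂ord]; exact Nat.pow_lt_pow_right (by norm_num) (Nat.lt_succ_self _)
  -- (4) compare exponents modulo `orderOf ζ = 2^k`
  have hζ0 : ζ ≠ 0 := fun h0 ↦ by
    rw [h0, zero_pow (pow_ne_zero k two_ne_zero)] at hζpow; exact zero_ne_one hζpow
  have key : ∀ {a b : ℕ}, a ≤ b → ζ ^ a = ζ ^ b → a ≡ b [MOD 2 ^ k] := fun {a b} hab h ↦ by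
    rw [Nat.modEq_iff_dvd' hab]
    obtain ⟨d, rfl⟩ := Nat.exists_eq_add_of_le hab
    rw [Nat.add_sub_cancel_left]
    rw [pow_add] at h
    have h1 : ζ ^ d = 1 := (mul_left_cancel₀ (pow_ne_zero a hζ0) ((mul_one (ζ ^ a)).trans h)).symm
    rw [← hord]; exact orderOf_dvd_of_pow_eq_one h1
  have hmod : n₁ * n₂ ≡ c [MOD 2 ^ k] := by
    have h := hσζ.symm.trans hεζ
    rcases le_total (n₁ * n₂) c with hle | hle
    · exact key hle h
    · exact (key hle h.symm).symm
  -- (5) assemble in `ℤ₂`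
  have hker : ∀ x : ℤ_[2], x ∈ (Ideal.span {(2 : ℤ_[2]) ^ k} : Ideal ℤ_[2]) ↔ PadicInt.toZModPow k x = 0 := fun x ↦ by
    rw [show (2 : ℤ_[2]) = ((2 : ℕ) : ℤ_[2]) by norm_cast, ← PadicInt.ker_toZModPow, RingHom.mem_ker]
  rw [hker, map_sub]
  have hc' : PadicInt.toZModPow k ((GaloisRep.cyclotomicCharacter L 2 σ : ℤ_[2]ˣ) : ℤ_[2]) = (c : ZMod (2 ^ k)) := by
    rw [hc, ZMod.natCast_zmod_val]
  rw [hc', map_intCast, sub_eq_zero]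
  -- `N₁ N₂ ≡ n₁ n₂ ≡ c (mod 2^k)`
  have h1 : ((N₁ * N₂ : ℤ) : ZMod (2 ^ k)) = ((n₁ * n₂ : ℕ) : ZMod (2 ^ k)) := by
    have hd : ((2 ^ k : ℕ) : ℤ) ∣ N₁ * N₂ - (n₁ * n₂ : ℕ) := by
      have : N₁ * N₂ - ((n₁ * n₂ : ℕ) : ℤ) = (N₁ - n₁) * N₂ + n₁ * (N₂ - n₂) := by push_cast; ring
      rw [this]
      exact dvd_add (dvd_mul_of_dvd_left hn₁ _) (dvd_mul_of_dvd_right hn₂ _)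
    rw [← sub_eq_zero, ← Int.cast_natCast, ← Int.cast_sub, ZMod.intCast_zmod_eq_zero_iff_dvd]
    exact_mod_cast hd
  rw [h1]
  push_cast
  exact_mod_cast (ZMod.natCast_eq_natCast_iff _ _ _).mpr hmod

end Weil

end Summit.BirchSwinnertonDyer.BirchSwinnertonDyer.Theorems.PrintCf2.CMPrimes

end
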